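import Summits.AtomisticToContinuum.HydrodynamicLimit.Theorems.CollisionIsometryCLTMacroClosureDefs

/-!
# Stub `stub_balance_B3` of the line `IdeatorTwoGen1Sketch` (crux `MacroClosure`, stmt-14870):
# the exact kinetic-flux algebra of block moments

Conjunct (B3) of `BalanceIdentity`: for a non-negative kernel `φ`, a configuration `z` of `N + 1`
spheres and a centre `x`, the block second moments and the block kinetic energy current of the
weighted empirical measure `φ(· − x) · emp z` decompose EXACTLY as
`∫ φ vⱼvₖ = ρ̄ ūⱼūₖ + ρ̄θ̄ δⱼₖ + Dⱼₖ` and `∫ φ |v|²/2 vⱼ = (Ē + ρ̄θ̄) ūⱼ + Σₖ Dⱼₖ ūₖ + qⱼ`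
in the block fields `bρ bm bE bu bθ bD bq` of the Defs file. Pure finite-dimensional algebra:
every integral against `empiricalMeasure z` is a finite weighted sum (`integral_empiricalMeasure`);
on an empty block (`ρ̄ = 0`, hence every weight `φ(xᵢ − x) = 0`) both sides vanish, otherwise
`ū = m̄/ρ̄` and `Σₗ ∫ φ (vₗ − ūₗ)² = 2Ē − |m̄|²/ρ̄ = 3ρ̄θ̄`.
-/

noncomputable section

open MeasureTheory Filter Set Topology InformationTheory
open scoped ENNReal ContDiff

namespace Summit.AtomisticToContinuum.HydrodynamicLimit.Theorems.MacroClosureLine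

open Literature.MathematicalPhysics.KineticTheory Literature.Analysis.FluidPDE
open Literature.Analysis.FunctionSpaces

namespace Barycentric

section Sums

variable {N : ℕ} (φ : T3 → ℝ) (z : Config (N + 1) (Fin 3) T3) (x : T3)

/-- The weighted empirical functional as a finite sum. -/
theorem integral_weight_mul_eq_sum (G : T3 × V3 → ℝ) :
    ∫ y, φ (y.1 - x) * G y ∂(empiricalMeasure z) =
      ((N + 1 : ℕ) : ℝ)⁻¹ * ∑ i, φ ((z i).1 - x) * G (z i) :=
  integral_empiricalMeasure z _

/-- Vector-valued integration against the empirical measure. -/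
theorem integral_empiricalMeasure_V3 (F : T3 × V3 → V3) :
    ∫ y, F y ∂(empiricalMeasure z) = ((N + 1 : ℕ) : ℝ)⁻¹ • ∑ i, F (z i) := by
  rw [empiricalMeasure_eq, integral_smul_measure, integral_finsetSum_measure]
  · simp only [integral_dirac, ENNReal.toReal_inv, ENNReal.toReal_natCast]
  · exact fun i _ => integrable_dirac (by simp)

/-- Block density as a finite sum. -/
theorem bρ_eq_sum : bρ φ z x = ((N + 1 : ℕ) : ℝ)⁻¹ * ∑ i, φ ((z i).1 - x) := by
  simp only [bρ, empiricalDensityField]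
  exact integral_empiricalMeasure z _

/-- Block energy as a finite sum. -/
theorem bE_eq_sum :
    bE φ z x = ((N + 1 : ℕ) : ℝ)⁻¹ * ∑ i, φ ((z i).1 - x) * (‖(z i).2‖ ^ 2 / 2) := by
  simp only [bE, empiricalEnergyField]
  exact integral_empiricalMeasure z _

/-- Block momentum coordinates as finite sums. -/
theorem bm_apply_eq_sum (j : Fin 3) :
    bm φ z x j = ((N + 1 : ℕ) : ℝ)⁻¹ * ∑ i, φ ((z i).1 - x) * (z i).2 j := by
  simp only [bm, empiricalMomentumField]
  rw [integral_empiricalMeasure_V3]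
  simp [WithLp.ofLp_sum, Finset.mul_sum]

/-- Block heat-flux coordinates as finite sums. -/
theorem bq_apply_eq_sum (j : Fin 3) :
    bq φ z x j = ((N + 1 : ℕ) : ℝ)⁻¹ *
      ∑ i, φ ((z i).1 - x) * (‖(z i).2 - bu φ z x‖ ^ 2 / 2 * ((z i).2 j - bu φ z x j)) := by
  simp only [bq]
  rw [integral_empiricalMeasure_V3]
  simp only [WithLp.ofLp_smul, WithLp.ofLp_sum, WithLp.ofLp_sub, Finset.sum_apply, Pi.smul_apply,
    Pi.sub_apply, smul_eq_mul, Finset.mul_sum]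
  exact Finset.sum_congr rfl fun i _ => by ring

/-! ## Linear expansions of the central moments -/

/-- Central second moments in raw moments. -/
theorem expand_central_second (j k : Fin 3) (u : V3) :
    ∫ y, φ (y.1 - x) * ((y.2 j - u j) * (y.2 k - u k)) ∂(empiricalMeasure z) =
      (∫ y, φ (y.1 - x) * (y.2 j * y.2 k) ∂(empiricalMeasure z)) - u k * bm φ z x j -
        u j * bm φ z x k + u j * u k * bρ φ z x := by
  rw [integral_weight_mul_eq_sum, integral_weight_mul_eq_sum, bm_apply_eq_sum, bm_apply_eq_sum,
    bρ_eq_sum]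
  simp only [Finset.mul_sum, ← Finset.sum_sub_distrib, ← Finset.sum_add_distrib]
  exact Finset.sum_congr rfl fun i _ => by ring

/-- Central squares in raw moments. -/
theorem expand_central_sq (l : Fin 3) (u : V3) :
    ∫ y, φ (y.1 - x) * (y.2 l - u l) ^ 2 ∂(empiricalMeasure z) =
      (∫ y, φ (y.1 - x) * (y.2 l * y.2 l) ∂(empiricalMeasure z)) - 2 * u l * bm φ z x l +
        u l ^ 2 * bρ φ z x := by
  rw [integral_weight_mul_eq_sum, integral_weight_mul_eq_sum, bm_apply_eq_sum, bρ_eq_sum]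
  simp only [Finset.mul_sum, ← Finset.sum_sub_distrib, ← Finset.sum_add_distrib]
  exact Finset.sum_congr rfl fun i _ => by ring

/-- Block energy as half the trace of the raw second moments. -/
theorem bE_eq_trace :
    bE φ z x = ((∫ y, φ (y.1 - x) * (y.2 0 * y.2 0) ∂(empiricalMeasure z)) +
      (∫ y, φ (y.1 - x) * (y.2 1 * y.2 1) ∂(empiricalMeasure z)) +
      (∫ y, φ (y.1 - x) * (y.2 2 * y.2 2) ∂(empiricalMeasure z))) / 2 := by
  rw [bE_eq_sum, integral_weight_mul_eq_sum, integral_weight_mul_eq_sum,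
    integral_weight_mul_eq_sum]
  simp only [EuclideanSpace.real_norm_sq_eq, Fin.sum_univ_three, Finset.mul_sum,
    ← Finset.sum_add_distrib, Finset.sum_div]
  exact Finset.sum_congr rfl fun i _ => by ring

/-- Block energy current in raw third moments. -/
theorem flux_eq_third (j : Fin 3) :
    ∫ y, φ (y.1 - x) * (‖y.2‖ ^ 2 / 2 * y.2 j) ∂(empiricalMeasure z) =
      ((∫ y, φ (y.1 - x) * (y.2 0 * y.2 0 * y.2 j) ∂(empiricalMeasure z)) +
        (∫ y, φ (y.1 - x) * (y.2 1 * y.2 1 * y.2 j) ∂(empiricalMeasure z)) +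
        (∫ y, φ (y.1 - x) * (y.2 2 * y.2 2 * y.2 j) ∂(empiricalMeasure z))) / 2 := by
  rw [integral_weight_mul_eq_sum, integral_weight_mul_eq_sum, integral_weight_mul_eq_sum,
    integral_weight_mul_eq_sum]
  simp only [EuclideanSpace.real_norm_sq_eq, Fin.sum_univ_three, Finset.mul_sum,
    ← Finset.sum_add_distrib, Finset.sum_div]
  exact Finset.sum_congr rfl fun i _ => by ring

/-- Block heat flux in raw moments (eighteen-term expansion of `φ |v − ū|²/2 (vⱼ − ūⱼ)`). -/
theorem bq_apply_expand (j : Fin 3) :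
    bq φ z x j =
      ((∫ y, φ (y.1 - x) * (y.2 0 * y.2 0 * y.2 j) ∂(empiricalMeasure z)) +
        (∫ y, φ (y.1 - x) * (y.2 1 * y.2 1 * y.2 j) ∂(empiricalMeasure z)) +
        (∫ y, φ (y.1 - x) * (y.2 2 * y.2 2 * y.2 j) ∂(empiricalMeasure z))) / 2 -
      bu φ z x j / 2 * ((∫ y, φ (y.1 - x) * (y.2 0 * y.2 0) ∂(empiricalMeasure z)) +
        (∫ y, φ (y.1 - x) * (y.2 1 * y.2 1) ∂(empiricalMeasure z)) +
        (∫ y, φ (y.1 - x) * (y.2 2 * y.2 2) ∂(empiricalMeasure z))) -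
      (bu φ z x 0 * (∫ y, φ (y.1 - x) * (y.2 j * y.2 0) ∂(empiricalMeasure z)) +
        bu φ z x 1 * (∫ y, φ (y.1 - x) * (y.2 j * y.2 1) ∂(empiricalMeasure z)) +
        bu φ z x 2 * (∫ y, φ (y.1 - x) * (y.2 j * y.2 2) ∂(empiricalMeasure z))) +
      bu φ z x j * (bu φ z x 0 * bm φ z x 0 + bu φ z x 1 * bm φ z x 1 + bu φ z x 2 * bm φ z x 2) +
      (bu φ z x 0 ^ 2 + bu φ z x 1 ^ 2 + bu φ z x 2 ^ 2) / 2 * bm φ z x j -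
      (bu φ z x 0 ^ 2 + bu φ z x 1 ^ 2 + bu φ z x 2 ^ 2) / 2 * bu φ z x j * bρ φ z x := by
  rw [bq_apply_eq_sum]
  simp only [integral_weight_mul_eq_sum, bm_apply_eq_sum, bρ_eq_sum]
  simp only [EuclideanSpace.real_norm_sq_eq, Fin.sum_univ_three, PiLp.sub_apply, Finset.mul_sum,
    ← Finset.sum_sub_distrib, ← Finset.sum_add_distrib, Finset.sum_div]
  exact Finset.sum_congr rfl fun i _ => by ring

/-! ## The empty block -/

/-- On an empty block every weight vanishes. -/
theorem weight_eq_zero (hφ : ∀ y, 0 ≤ φ y) (hρ : bρ φ z x = 0) (i : Fin (N + 1)) :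
    φ ((z i).1 - x) = 0 := by
  rw [bρ_eq_sum, mul_eq_zero] at hρ
  have hs := hρ.resolve_left (inv_ne_zero (Nat.cast_pos.mpr (Nat.succ_pos N)).ne')
  rw [Finset.sum_eq_zero_iff_of_nonneg fun i _ => hφ _] at hs
  exact hs i (Finset.mem_univ _)

/-- On an empty block every weighted integral vanishes. -/
theorem integral_weight_mul_eq_zero (hφ : ∀ y, 0 ≤ φ y) (hρ : bρ φ z x = 0) (G : T3 × V3 → ℝ) :
    ∫ y, φ (y.1 - x) * G y ∂(empiricalMeasure z) = 0 := by
  rw [integral_weight_mul_eq_sum]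
  simp [weight_eq_zero φ z x hφ hρ]

/-! ## The two identities -/

/-- (B3a) block second moments `= ρ̄ ūⱼūₖ + ρ̄θ̄ δⱼₖ + Dⱼₖ`. -/
theorem balance_second_moments (hφ : ∀ y, 0 ≤ φ y) (j k : Fin 3) :
    ∫ y, φ (y.1 - x) * (y.2 j * y.2 k) ∂(empiricalMeasure z) =
      bρ φ z x * (bu φ z x j * bu φ z x k) + (if j = k then bρ φ z x * bθ φ z x else 0) +
        bD φ z x j k := by
  by_cases hρ : bρ φ z x = 0
  · have hI0 := integral_weight_mul_eq_zero φ z x hφ hρ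
    simp [bD, hI0, hρ]
  · rw [bD, expand_central_second, Fin.sum_univ_three, expand_central_sq, expand_central_sq,
      expand_central_sq, bθ, bE_eq_trace, EuclideanSpace.real_norm_sq_eq (bm φ z x),
      Fin.sum_univ_three]
    simp only [bu, PiLp.smul_apply, smul_eq_mul]
    split_ifs with hjk
    · subst hjk
      field_simp
      ring
    · field_simp
      ring

/-- (B3b) block energy current `= (Ē + ρ̄θ̄) ūⱼ + Σₖ Dⱼₖ ūₖ + qⱼ`. -/
theorem balance_energy_current (hφ : ∀ y, 0 ≤ φ y) (j : Fin 3) :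
    ∫ y, φ (y.1 - x) * (‖y.2‖ ^ 2 / 2 * y.2 j) ∂(empiricalMeasure z) =
      (bE φ z x + bρ φ z x * bθ φ z x) * bu φ z x j + (∑ k, bD φ z x j k * bu φ z x k) +
        bq φ z x j := by
  by_cases hρ : bρ φ z x = 0
  · have hw := weight_eq_zero φ z x hφ hρ
    have hI0 := integral_weight_mul_eq_zero φ z x hφ hρ
    have hq0 : bq φ z x j = 0 := by
      rw [bq_apply_eq_sum]
      simp [hw]
    have hE0 : bE φ z x = 0 := by
      rw [bE_eq_sum]
      simp [hw]
    have hD0 : ∀ k, bD φ z x j k = 0 := fun k => by simp [bD, hI0]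
    simp [hI0, hq0, hE0, hD0, hρ]
  · have hD : ∀ k, bD φ z x j k = (∫ y, φ (y.1 - x) * (y.2 j * y.2 k) ∂(empiricalMeasure z)) -
        bρ φ z x * (bu φ z x j * bu φ z x k) - (if j = k then bρ φ z x * bθ φ z x else 0) :=
      fun k => by rw [balance_second_moments φ z x hφ j k]; ring
    simp only [hD, sub_mul, Finset.sum_sub_distrib, ite_mul, zero_mul, Finset.sum_ite_eq,
      Finset.mem_univ, if_true]
    rw [Fin.sum_univ_three, Fin.sum_univ_three, flux_eq_third, bq_apply_expand, bθ, bE_eq_trace,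
      EuclideanSpace.real_norm_sq_eq (bm φ z x), Fin.sum_univ_three]
    simp only [bu, PiLp.smul_apply, smul_eq_mul]
    field_simp
    ring

end Sums

/-- **(B3) of `BalanceIdentity`** — the exact kinetic-flux algebra of block moments for a
non-negative kernel: block second moments `∫ φ(·−x) vⱼvₖ d(emp z) = ρ̄ ūⱼūₖ + ρ̄θ̄ δⱼₖ + Dⱼₖ` and
block energy current `∫ φ(·−x) |v|²/2 vⱼ d(emp z) = (Ē + ρ̄θ̄) ūⱼ + Σₖ Dⱼₖ ūₖ + qⱼ`. -/
theorem stub_balance_B3 : ∀ (N : ℕ) (φ : T3 → ℝ), (∀ y, 0 ≤ φ y) → ∀ (z : Config (N + 1) (Fin 3) T3) (x : T3), (∀ j k : Fin 3, ∫ y, φ (y.1 - x) * (y.2 j * y.2 k) ∂(empiricalMeasure z) = bρ φ z x * (bu φ z x j * bu φ z x k) + (if j = k then bρ φ z x * bθ φ z x else 0) + bD φ z x j k) ∧ (∀ j : Fin 3, ∫ y, φ (y.1 - x) * (‖y.2‖ ^ 2 / 2 * y.2 j) ∂(empiricalMeasure z) = (bE φ z x + bρ φ z x * bθ φ z x) *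 bu φ z x j + (∑ k, bD φ z x j k * bu φ z x k) + bq φ z x j) :=
  fun _ φ hφ z x => ⟨balance_second_moments φ z x hφ, balance_energy_current φ z x hφ⟩

end Barycentric

end Summit.AtomisticToContinuum.HydrodynamicLimit.Theorems.MacroClosureLine

end
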